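import Summits.QuantumFields.YangMills.Theorems.FemtoCutoffLadderLocalWallRarityDoors
import Summits.QuantumFields.YangMills.Theorems.FemtoCutoffLadderLocalWallLowerBounds
import Summits.QuantumFields.YangMills.Theorems.FemtoTransferGapOneSiteScaling

/-!
# Route `FemtoCutoffLadder`, crux `LocalWallStep` (stmt-QuantumFields-26282) BY NAME from ONE explicit hypothesis:
# one-plaquette rarity of near-optimal walled trial states (★★★ `localWallStep_of_onePlaquetteRarity`)

Seat `leafhand-qf-femtocutoffladder-2` g0 (2026-08-30), `--supports stmt-QuantumFields-26282`.  Assembly of this seat's doors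
(✓p793595 `localWallStep_of_oneWallLowerBounds`, ✓p794057/p794326 cut bounds, ✓p794606 rarity doors) with the sibling floor
✓p793746 `walledSecond_pos`: the analogue, for LINE g5-A «one plaquette wall at a time», of `largeFieldInsensitivity_text_of_eigenRarity`
(sfw-p1 g10) for the parent crux — but EIGENFUNCTION-FREE (walled problems have no spectral package in the tree and need none).

THE HYPOTHESIS (R) — `∀ κ ∈ (0,1) ∃ A > 0, lam0 > 0, L0 ∀ lam ∈ (0,lam0] ∀ L ≥ L0 ∀ β` in the femto window, with `N = #Plaquette 3 L`,
`c = (1 − e^{−A/(2β²NL)})/2 (≈ A/(4β²NL))`, for every wall set `Q` and `p₀ ∉ Q`: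
 (R_T) every physical `f` admissible for `W Q` with Rayleigh quotient `≥ (1−c)² · t Q` puts at most the fraction `c² · tQ/λ₀` of `‖f‖²` on
       «`p₀` is κ-bad» (`β^{κ−1} < 2 − Re tr U_{p₀}`);
 (R_S) every `l2`-orthonormal physical pair admissible for `W Q` whose span has Rayleigh floor `(1−c)² · s Q` puts, span-uniformly, at most
       the fraction `c² · sQ/λ₀` on «`p₀` is κ-bad».
THE THEOREM: (R) ⟹ `LocalWallStep` (same `A, lam0, L0`).  Real-number core (§1): with `δ = X(1 − (1−c)²)`, `λ₀ε = Xc²` the door value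
`(√(X−δ) − √(λ₀ε))² = X(1 − 2c)² = X e^{−A/(β²NL)}` exactly.
HONEST FRAMING: (R) is NOT proved — it is the quantitative form of the line's physics («walling off the κ-bad region of ONE more plaquette
costs near-optimal femto states a `1/N`-share of a stretched-exponentially rare event», truth `ε ~ e^{−cβ^κ} ≪ (A/(β²NL))²`), an `L`-uniform
Bałaban-type large-field estimate for WALLED near-optimal states, not in print (XL).  R2b1 is a RECORD rung — not infinite volume, not a mass
gap, not Clay; no summit is proved by this file.  No definitions, no named facts, no `sorry`.  [cite: ReedSimonIV1978, Thm. XIII.1]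
[cite: Balaban1989LargeFieldI]
-/

set_option autoImplicit false

noncomputable section

open MeasureTheory Filter Topology Real
open Literature.MathematicalPhysics.QuantumFieldTheory hiding SU2
open Literature.MathematicalPhysics.QuantumLattice

namespace Summit.QuantumFields.YangMills.Theorems.FemtoTransferGap.SFCompression

variable {L : ℕ} [NeZero L]

/-! ## §1 Real-number core -/

/-- `(√(X(1−c)²) − √(Xc²))² = X(1 − 2c)²` for `X ≥ 0`, `0 ≤ c ≤ 1`. [folklore] -/
theorem sqrt_gap_sq_eq {X c : ℝ} (hX : 0 ≤ X) (hc0 : 0 ≤ c) (hc1 : c ≤ 1) :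
    (Real.sqrt (X * (1 - c) ^ 2) - Real.sqrt (X * c ^ 2)) ^ 2 = X * (1 - 2 * c) ^ 2 := by
  rw [Real.sqrt_mul hX, Real.sqrt_mul hX, Real.sqrt_sq (by linarith), Real.sqrt_sq hc0, ← mul_sub, mul_pow,
    Real.sq_sqrt hX]
  ring

/-- The rate `c = (1 − e^{−a/2})/2` of a positive allowance: `0 < c < 1/2`, `1 − 2c = e^{−a/2}` and `(e^{−a/2})² = e^{−a}`. [folklore] -/
theorem rate_facts {a : ℝ} (ha : 0 < a) :
    0 < (1 - Real.exp (-(a / 2))) / 2 ∧ (1 - Real.exp (-(a / 2))) / 2 < 1 / 2 ∧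
      (1 - 2 * ((1 - Real.exp (-(a / 2))) / 2)) ^ 2 = Real.exp (-a) := by
  have h1 : Real.exp (-(a / 2)) < 1 := Real.exp_lt_one_iff.mpr (by linarith)
  have h2 : 0 < Real.exp (-(a / 2)) := Real.exp_pos _
  refine ⟨by linarith, by linarith, ?_⟩
  have : 1 - 2 * ((1 - Real.exp (-(a / 2))) / 2) = Real.exp (-(a / 2)) := by ring
  rw [this, sq, ← Real.exp_add]
  congr 1; ring

/-! ## §2 ★★★ `LocalWallStep` from one-plaquette rarity of near-optimal walled trial states -/
set_option maxHeartbeats 400000 in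
open Summit.QuantumFields.YangMills.Theses.FemtoCutoffLadder in
/-- ★★★ **`LocalWallStep` BY NAME from the one-plaquette rarity hypothesis (R) = (R_T) ∧ (R_S)** (module docstring).  Per window lattice
and wall step: (R_T) feeds ✓`le_walledTop_insert_of_rarity` with `δ = tQ(1 − (1−c)²)`, `ε = c² tQ/λ₀`, whose value is exactly `tQ · e^{−A/(β²NL)}`
(§1), giving (T) `t Q ≤ e^{A/(β²N)/L} t (Q ∪ {p₀})`; (R_S) feeds ✓`le_walledSecond_insert_of_planeRarity` likewise, giving (S); then
✓`localWallStep_of_oneWallLowerBounds`. [cite: ReedSimonIV1978, Thm. XIII.1] -/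
theorem localWallStep_of_onePlaquetteRarity
    (hR : ∀ κ : ℝ, 0 < κ → κ < 1 → ∃ (A lam0 : ℝ) (L0 : ℕ), 0 < A ∧ 0 < lam0 ∧ ∀ lam : ℝ, 0 < lam → lam ≤ lam0 →
      ∀ (L : ℕ) [NeZero L], L0 ≤ L → ∀ β : ℝ, InFemtoWindow lam β L →
      let W : Set (Plaquette 3 L) → (GaugeConfig 3 L SU2 → ℝ) → Prop := fun Q ψ => ∀ U,
        (∃ p ∈ Q, β ^ (κ - 1) < 2 - (su2Rep (plaquetteHolonomy U p.1 p.2.1.1 p.2.1.2)).trace.re) → ψ U = 0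
      let t : Set (Plaquette 3 L) → ℝ := fun Q => sSup (rayleighSet su2Rep L β (W Q))
      let s : Set (Plaquette 3 L) → ℝ := fun Q => sInf {x : ℝ | ∃ φ : GaugeConfig 3 L SU2 → ℝ, IsPhys φ ∧
        x = sSup (rayleighSet su2Rep L β fun ψ => W Q ψ ∧ l2 ψ φ = 0)}
      let c : ℝ := (1 - Real.exp (-(A / β ^ 2 / (Fintype.card (Plaquette 3 L) : ℝ) / L / 2))) / 2
      let B : Plaquette 3 L → Set (GaugeConfig 3 L SU2) := fun p₀ =>
        {U | β ^ (κ - 1) < 2 - (su2Rep (plaquetteHolonomy U p₀.1 p₀.2.1.1 p₀.2.1.2)).trace.re}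
      ∀ (Q : Set (Plaquette 3 L)) (p₀ : Plaquette 3 L), p₀ ∉ Q →
        (∀ f : GaugeConfig 3 L SU2 → ℝ, IsPhys f → W Q f → 0 < l2 f f →
            t Q * (1 - c) ^ 2 * l2 f f ≤ qform su2Rep β f f →
            l2 ((B p₀).indicator f) ((B p₀).indicator f) ≤ t Q * c ^ 2 / topValue su2Rep L β * l2 f f) ∧
        (∀ f₁ f₂ : GaugeConfig 3 L SU2 → ℝ, IsPhys f₁ → IsPhys f₂ → W Q f₁ → W Q f₂ →
            l2 f₁ f₁ = 1 → l2 f₂ f₂ = 1 → l2 f₁ f₂ = 0 →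
            (∀ a b : ℝ, s Q * (1 - c) ^ 2 * (a ^ 2 + b ^ 2) ≤ qform su2Rep β (a • f₁ + b • f₂) (a • f₁ + b • f₂)) →
            ∀ a b : ℝ, l2 ((B p₀).indicator (a • f₁ + b • f₂)) ((B p₀).indicator (a • f₁ + b • f₂)) ≤
              s Q * c ^ 2 / topValue su2Rep L β * (a ^ 2 + b ^ 2))) :
    LocalWallStep := by
  refine Summit.QuantumFields.YangMills.Theorems.FemtoCutoffLadder.localWallStep_of_oneWallLowerBounds fun κ hκ hκ1 => ?_
  obtain ⟨A, lam0, L0, hA, hlam0, H⟩ := hR κ hκ hκ1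
  refine ⟨A, lam0, L0, hA.le, hlam0, fun lam hlam hle L _ hL0 β hW => ?_⟩
  have hβ : 0 < β := by linarith [hW.1]
  intro W t s Q p₀ hp₀
  obtain ⟨HT, HS⟩ := H lam hlam hle L hL0 β hW Q p₀ hp₀
  -- constants of this wall step
  have hNpos : 0 < (Fintype.card (Plaquette 3 L) : ℝ) := by
    have : 0 < Fintype.card (Plaquette 3 L) := Fintype.card_pos_iff.mpr ⟨p₀⟩
    exact_mod_cast this
  have hLpos : 0 < (L : ℝ) := Nat.cast_pos.mpr (Nat.pos_of_ne_zero (NeZero.ne L))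
  set a' : ℝ := A / β ^ 2 / (Fintype.card (Plaquette 3 L) : ℝ) / L with ha'
  have ha'pos : 0 < a' := by positivity
  set c : ℝ := (1 - Real.exp (-(A / β ^ 2 / (Fintype.card (Plaquette 3 L) : ℝ) / L / 2))) / 2 with hcdef
  have hca : c = (1 - Real.exp (-(a' / 2))) / 2 := by rw [hcdef, ha']
  obtain ⟨hc0, hc12, hc2⟩ := rate_facts ha'pos
  rw [← hca] at hc0 hc12 hc2
  have hl0 : 0 < topValue su2Rep L β := topValue_su2Rep_pos L β
  have hcsq : c ^ 2 ≤ (1 - c) ^ 2 := by nlinarith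
  constructor
  · -- (T): the top half
    have hX : 0 < t Q := walledTop_pos L hβ κ Q
    have hXle : t Q ≤ topValue su2Rep L β := sSup_rayleighSet_le_topValue hβ.le _
    set δ : ℝ := t Q - t Q * (1 - c) ^ 2 with hδdef
    set ε : ℝ := t Q * c ^ 2 / topValue su2Rep L β with hεdef
    have hXδ : t Q - δ = t Q * (1 - c) ^ 2 := by rw [hδdef]; ring
    have hlmε : topValue su2Rep L β * ε = t Q * c ^ 2 := by rw [hεdef]; field_simp
    have hδ : 0 < δ := by
      have h1 : 0 < 1 - (1 - c) ^ 2 := by nlinarith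
      have h2 := mul_pos hX h1
      rw [hδdef]; nlinarith [h2]
    have hε1 : ε < 1 := by
      have h1 : ε ≤ c ^ 2 := by
        rw [hεdef, div_le_iff₀ hl0]; nlinarith [sq_nonneg c]
      nlinarith
    have hεm : topValue su2Rep L β * ε ≤ t Q - δ := by
      rw [hlmε, hXδ]; exact mul_le_mul_of_nonneg_left hcsq hX.le
    have door := le_walledTop_insert_of_rarity hβ κ Q p₀ hδ hε1 hεm (fun f hf hWf hpos hm => by
      rw [hXδ] at hm
      have h := HT f hf hWf hpos hm
      rw [hεdef]
      exact h)
    have key : Real.exp (-a') * t Q ≤ (Real.sqrt (t Q - δ) - Real.sqrt (topValue su2Rep L β * ε)) ^ 2 := by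
      rw [hXδ, hlmε, sqrt_gap_sq_eq hX.le hc0.le (by linarith), hc2, mul_comm]
    exact le_exp_mul_of_exp_neg_mul_le (le_trans key door)
  · -- (S): the second half
    have hX : 0 < s Q := walledSecond_pos L hβ κ Q
    have hXle : s Q ≤ topValue su2Rep L β :=
      (compressedSecond_le_sSup_rayleighSet hβ.le _).trans (sSup_rayleighSet_le_topValue hβ.le _)
    set δ : ℝ := s Q - s Q * (1 - c) ^ 2 with hδdef
    set ε : ℝ := s Q * c ^ 2 / topValue su2Rep L β with hεdef
    have hXδ : s Q - δ = s Q * (1 - c) ^ 2 := by rw [hδdef]; ring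
    have hlmε : topValue su2Rep L β * ε = s Q * c ^ 2 := by rw [hεdef]; field_simp
    have hδ : 0 < δ := by
      have h1 : 0 < 1 - (1 - c) ^ 2 := by nlinarith
      have h2 := mul_pos hX h1
      rw [hδdef]; nlinarith [h2]
    have hε1 : ε < 1 := by
      have h1 : ε ≤ c ^ 2 := by
        rw [hεdef, div_le_iff₀ hl0]; nlinarith [sq_nonneg c]
      nlinarith
    have hεm : topValue su2Rep L β * ε ≤ s Q - δ := by
      rw [hlmε, hXδ]; exact mul_le_mul_of_nonneg_left hcsq hX.le
    have door := le_walledSecond_insert_of_planeRarity hβ κ Q p₀ hδ hε1 hεm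
      (fun f₁ f₂ h₁ h₂ hW₁ hW₂ hn₁ hn₂ horth hfloor a b => by
        have hfloor' : ∀ a b : ℝ, s Q * (1 - c) ^ 2 * (a ^ 2 + b ^ 2) ≤
            qform su2Rep β (a • f₁ + b • f₂) (a • f₁ + b • f₂) := fun a b => by
          have h := hfloor a b
          rw [hXδ] at h
          exact h
        have h := HS f₁ f₂ h₁ h₂ hW₁ hW₂ hn₁ hn₂ horth hfloor' a b
        rw [hεdef]
        exact h)
    have key : Real.exp (-a') * s Q ≤ (Real.sqrt (s Q - δ) - Real.sqrt (topValue su2Rep L β * ε)) ^ 2 := by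
      rw [hXδ, hlmε, sqrt_gap_sq_eq hX.le hc0.le (by linarith), hc2, mul_comm]
    exact le_exp_mul_of_exp_neg_mul_le (le_trans key door)

end Summit.QuantumFields.YangMills.Theorems.FemtoTransferGap.SFCompression

end
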